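import Summits.HodgeConjecture.HodgeConjecture.Theorems.F0P3cStCharTSHCDescentSemisimple             -- (this seat) ★ p852163 file D: `exists_nhds_setLIntegral_lt_top_of_slice` (brings C₂, C₁, A)
import Summits.HodgeConjecture.HodgeConjecture.Theorems.F0P3cStCharTSHCDescentSemisimpleNormalForm   -- (this seat) ★ p852220 file E₂ (ii-Q): `exists_nhds_setLIntegral_etaInv_lt_top_normalForm` (brings E₁)
import Summits.HodgeConjecture.HodgeConjecture.Theorems.F0P3cStCharTSHCDSliceConjTransport           -- ★ p852227 (F0P2-p06) (ii-T): `exists_ball_setLIntegral_lt_top_iff_conj`, `exists_ball_iff_exists_nhds`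
import Summits.HodgeConjecture.HodgeConjecture.Theorems.F0P3cStCharTSHCDLieGlobal                    -- ★ (F0P3a-p07) GLOBAL: `continuous_etaInv`
import HarnessLib

/-!
# F0 · P3c · line LH6 «StCharTS» — ROAD «HC-D», brick (D5ii) «SEMISIMPLE DESCENT AT TYPE (a,a,b)», FINAL ASSEMBLY ON `↥𝔲`:
# `ηι = |disc χ|_K^{−1∕4}` is `∫⁻`-finite near every split-semisimple non-regular `X₀ ∈ 𝔲` admitting a normal-form basis

Cell `pub/hodgecm-mathlib`, crux H413 = `stmt-HodgeConjecture-24833` (lane `--supports … --as helper`), route HCCMUnconditional; seat F0P3a-p05 (g23); dealer F0P2-p01 (g23).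
THEOREMS ONLY (no definition ∕ instance ∕ notation ∕ named fact ∕ `sorry`); ★-only imports: file D (this seat), file E₂ (this seat), (ii-T) (F0P2-p06), GLOBAL (F0P3a-p07).
HONEST LABEL: HC_CM is proved only modulo the 7 printed citations (2 remaining: hLiu418 = `stmt-HodgeConjecture-24832`, h413 = `stmt-HodgeConjecture-24833`) until rung 0
closes; count-neutral analysis for the named input (HC-D) «`|D_G|^{−1∕2} ∈ L¹_loc(G)`» [HarishChandra1970, Part VII §1 Thm. 15]; closes no organ.

WHAT IT DOES (road frame `[Field K] [ValuativeRel K] [TopologicalSpace K] [IsNonarchimedeanLocalField K] [CharZero K]`, `𝔲 : AddSubgroup`, ANY Borel structure and ANY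
additive Haar measure `μ` on `↥𝔲`, the R2 token `ηι` verbatim).  **`exists_nhds_setLIntegral_etaInv_lt_top_of_normalFormBasis`**: given `X₀ ∈ 𝔲` with
`(X₀ − a)(X₀ − b) = 0`, `a ≠ b`, and a NORMAL-FORM BASIS `g` (`g⁻¹ X₀ g = diag(a,a,b)`, `ᵗ(σg) J g = diag(d)`, `d` `σ`-fixed and invertible — the output of (ii-B), LH10-p01),
`∃ U ∈ 𝓝 X₀, ∫⁻ X in U, ηι X ∂μ < ∞`.  Chain: the `K`-façade `nontriviallyNormedField K` (topology `rfl`-equal to the given one), `𝔲` re-read as a `ℚ`-submodule (same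
subtype), `p = (X − a)(X − b)` separable; ★ file D reduces to ball-finiteness of `Z ↦ ηι(X₀ + Z)` on the centraliser slice `𝔠_J(X₀)`; ★ (ii-T) moves it to
`𝔠_{J′}(g⁻¹X₀g) = 𝔠_{diag d}(diag(a,a,b))` (class function, any Haar measures); there ★ E₂ (coordinates E₁, ★ file A factorisation, ★ D3b, ★ G-FUB) gives it.
The (ii-B) existence statement is consumed by the sequel head once ★ (this file takes the basis as data, so it is unconditional).

## References
* [HarishChandra1970] Harish-Chandra (notes by G. van Dijk), *Harmonic Analysis on Reductive p-adic Groups*, LNM 162 (1970), Part VI Lemma 22; Part VII §1 Thm. 15.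
* [Rogawski1990] J. D. Rogawski, *Automorphic Representations of Unitary Groups in Three Variables*, Ann. of Math. Stud. 123 (1990), §3.6 pp. 28–31; §12.5 p. 184.
* [Folland1999] G. B. Folland, *Real Analysis* (2nd ed., 1999), §2.5 Thm. 2.37, §11.1 Thm. 11.9.
-/

set_option autoImplicit false
-- the mandated namespace has the single-problem summit's repeated segment (`HodgeConjecture.HodgeConjecture`)
set_option linter.dupNamespace false

noncomputable section

open MeasureTheory MeasureTheory.Measure Filter Topology Set Matrix Metric Polynomial
open scoped NNReal ENNReal Matrix Matrix.Norms.Elementwise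
open Literature.NumberTheory.GaloisRepresentations Literature.NumberTheory.GaloisRepresentations.IsNonarchimedeanLocalField
open Literature.NumberTheory.Automorphic
open Summit.HodgeConjecture.HodgeConjecture.Cruxes.H413.F0P3cStCharTSHCDescentSemisimpleSliceK
open Summit.HodgeConjecture.HodgeConjecture.Cruxes.H413.F0P3cStCharTSHCDescentSemisimple
open Summit.HodgeConjecture.HodgeConjecture.Cruxes.H413.F0P3cStCharTSHCDescentSemisimpleNormalForm
open Summit.HodgeConjecture.HodgeConjecture.Cruxes.H413.F0P3cStCharTSHCDSliceConjTransport
open Summit.HodgeConjecture.HodgeConjecture.Cruxes.H413.F0P3cStCharTSHCDLieGlobal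

namespace Summit.HodgeConjecture.HodgeConjecture.Cruxes.H413.F0P3cStCharTSHCDescentSemisimpleAssembly

/-! ## §1 Skewness is `ℚ`-linear; the skew `ℚ`-submodule -/

section Rat

variable {K : Type*} [Field K] [CharZero K]

/-- Rational multiples of `J`-skew matrices are `J`-skew (`σ` fixes `ℚ`). [cite: Rogawski1990, §3.6 pp. 28–31] -/
theorem skew_rat_smul (σ : K →+* K) (J : Matrix (Fin 3) (Fin 3) K) (c : ℚ) {X : Matrix (Fin 3) (Fin 3) K}
    (hX : (X.map σ)ᵀ * J + J * X = 0) : ((c • X).map σ)ᵀ * J + J * (c • X) = 0 := by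
  have hmap : (c • X).map σ = c • X.map σ := Matrix.ext fun i j => map_rat_smul σ c (X i j)
  rw [hmap, transpose_smul, Matrix.smul_mul, Matrix.mul_smul, ← smul_add, hX, smul_zero]

/-- The `J`-skew matrices form a `ℚ`-submodule (existence with membership criterion). [cite: Rogawski1990, §3.6 pp. 28–31] -/
theorem exists_ratSubmodule_skew (σ : K →+* K) (J : Matrix (Fin 3) (Fin 3) K) :
    ∃ 𝔲 : Submodule ℚ (Matrix (Fin 3) (Fin 3) K), ∀ X, X ∈ 𝔲 ↔ (X.map σ)ᵀ * J + J * X = 0 := by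
  refine ⟨{ carrier := {X | (X.map σ)ᵀ * J + J * X = 0}, add_mem' := fun {X Y} hX hY => ?_, zero_mem' := ?_, smul_mem' := fun c X hX => skew_rat_smul σ J c hX },
    fun X => Iff.rfl⟩
  · simp only [Set.mem_setOf_eq] at hX hY ⊢
    rw [Matrix.map_add σ (map_add σ), transpose_add, Matrix.add_mul, Matrix.mul_add, add_add_add_comm, hX, hY, add_zero]
  · simp only [Set.mem_setOf_eq, Matrix.map_zero σ (map_zero σ), transpose_zero, Matrix.zero_mul, Matrix.mul_zero, add_zero]

end Rat

/-! ## §2 The assembly -/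

section Assembly

variable {K : Type*} [Field K] [ValuativeRel K] [TopologicalSpace K] [IsNonarchimedeanLocalField K] [CharZero K]

/-- The centraliser slice `𝔳 ⊓ ker(ad_S)` of a skew submodule is closed in `M₃(K)`. [cite: HarishChandra1970, Part VI Lemma 22] -/
theorem isClosed_slice {σ : K →+* K} (hσc : Continuous σ) (J₁ S : Matrix (Fin 3) (Fin 3) K) (𝔳 : Submodule ℚ (Matrix (Fin 3) (Fin 3) K))
    (h𝔳 : ∀ X, X ∈ 𝔳 ↔ (X.map σ)ᵀ * J₁ + J₁ * X = 0) :
    IsClosed ((𝔳 ⊓ (LinearMap.ker (LinearMap.mulLeft K S - LinearMap.mulRight K S : Module.End K (Matrix (Fin 3) (Fin 3) K))).restrictScalars ℚ :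
      Submodule ℚ (Matrix (Fin 3) (Fin 3) K)) : Set (Matrix (Fin 3) (Fin 3) K)) := by
  haveI : T2Space K := (IsNonarchimedeanLocalField.isLocalField K).toT2Space
  have hset : ((𝔳 ⊓ (LinearMap.ker (LinearMap.mulLeft K S - LinearMap.mulRight K S : Module.End K (Matrix (Fin 3) (Fin 3) K))).restrictScalars ℚ :
      Submodule ℚ (Matrix (Fin 3) (Fin 3) K)) : Set (Matrix (Fin 3) (Fin 3) K)) =
      {X | (X.map σ)ᵀ * J₁ + J₁ * X = 0} ∩ {X | S * X - X * S = 0} := Set.ext fun X => by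
    simp only [SetLike.mem_coe, Submodule.mem_inf, Submodule.restrictScalars_mem, LinearMap.mem_ker, LinearMap.sub_apply, LinearMap.mulLeft_apply,
      LinearMap.mulRight_apply, Set.mem_inter_iff, Set.mem_setOf_eq, h𝔳 X]
  rw [hset]
  exact (isClosed_eq (((continuous_id.matrix_map hσc).matrix_transpose.matrix_mul continuous_const).add (continuous_const.matrix_mul continuous_id))
    continuous_const).inter (isClosed_eq ((continuous_const.matrix_mul continuous_id).sub (continuous_id.matrix_mul continuous_const)) continuous_const)

/-- **SEMISIMPLE DESCENT AT TYPE `(a,a,b)`, GIVEN A NORMAL-FORM BASIS** (ROAD «HC-D», brick (D5ii), final assembly).  Road frame: `σ` a continuous involution of the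
char-0 non-archimedean local field `K` whose fixed field is the closed-embedded local field `ι : F′ → K` (norm bridge `|ι x|_K = |x|²_{F′}`), `lam` a skew unit,
`2 ≠ 0`; `J` with `det J` a unit; `𝔲 = 𝔲(J)` the additive group of `J`-skew matrices with ANY Borel structure and ANY additive Haar measure `μ`.  If `X₀ ∈ 𝔲` satisfies
`(X₀ − a)(X₀ − b) = 0` with `a ≠ b` and admits a normal-form basis `g` (`det g` a unit, `g⁻¹ X₀ g = diagonal ![a, a, b]`, `ᵗ(σ g) J g = diagonal d` with `σ dᵢ = dᵢ ≠ 0`),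
then `ηι X = (↑√√|disc χ_X|_K)⁻¹` has finite `∫⁻` on a neighbourhood of `X₀` in `↥𝔲`.
[cite: HarishChandra1970, Part VI Lemma 22; Part VII §1 Thm. 15] [cite: Rogawski1990, §3.6 pp. 28–31; §12.5 p. 184] [cite: Folland1999, §11.1 Thm. 11.9] -/
theorem exists_nhds_setLIntegral_etaInv_lt_top_of_normalFormBasis
    (σ : K →+* K) (hσ : ∀ x, σ (σ x) = x) (hσc : Continuous σ)
    {J : Matrix (Fin 3) (Fin 3) K} (hJd : IsUnit J.det) (h2 : (2 : K) ≠ 0)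
    (lam : Kˣ) (hlam : σ (lam : K) = -(lam : K))
    (𝔲 : AddSubgroup (Matrix (Fin 3) (Fin 3) K)) (h𝔲 : ∀ X, X ∈ 𝔲 ↔ (X.map σ)ᵀ * J + J * X = 0)
    [MeasurableSpace ↥𝔲] [BorelSpace ↥𝔲] (μ : Measure ↥𝔲) [μ.IsAddHaarMeasure]
    {F' : Type*} [Field F'] [ValuativeRel F'] [TopologicalSpace F'] [IsNonarchimedeanLocalField F']
    (ι : F' →+* K) (hι : IsClosedEmbedding ι) (hιr : ∀ x, σ x = x ↔ x ∈ Set.range ι)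
    (hιn : ∀ x : F', IsNonarchimedeanLocalField.normAbs K (ι x) = IsNonarchimedeanLocalField.normAbs F' x ^ 2)
    (X₀ : ↥𝔲) {a b : K} (hab : a ≠ b)
    (hmin : ((X₀ : Matrix (Fin 3) (Fin 3) K) - a • (1 : Matrix (Fin 3) (Fin 3) K)) * ((X₀ : Matrix (Fin 3) (Fin 3) K) - b • 1) = 0)
    {g : Matrix (Fin 3) (Fin 3) K} (hg : IsUnit g.det) (hgX : g⁻¹ * (X₀ : Matrix (Fin 3) (Fin 3) K) * g = diagonal ![a, a, b])
    {d : Fin 3 → K} (hd : ∀ i, σ (d i) = d i ∧ d i ≠ 0) (hgJ : (g.map σ)ᵀ * J * g = diagonal d) :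
    ∃ U ∈ 𝓝 X₀, ∫⁻ X in U,
      ((NNReal.sqrt (NNReal.sqrt (IsNonarchimedeanLocalField.normAbs K (Matrix.charpoly (X : Matrix (Fin 3) (Fin 3) K)).discr)) : ℝ≥0∞))⁻¹ ∂μ < ∞ := by
  classical
  -- the `K`-façade (topology `rfl`-equal to the given one) and the Borel structures
  letI : NontriviallyNormedField K := nontriviallyNormedField K
  haveI : CompleteSpace K := completeSpace_nontriviallyNormedField K
  haveI : IsUltrametricDist K := isUltrametricDist_nontriviallyNormedField K
  haveI : ProperSpace K := ProperSpace.of_nontriviallyNormedField_of_weaklyLocallyCompactSpace K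
  haveI : SecondCountableTopology K := secondCountableTopology_localField K
  haveI : SecondCountableTopology F' := secondCountableTopology_localField F'
  haveI : T2Space F' := (IsNonarchimedeanLocalField.isLocalField F').toT2Space
  haveI : SecondCountableTopology (Matrix (Fin 3) (Fin 3) K) := inferInstanceAs (SecondCountableTopology (Fin 3 → Fin 3 → K))
  haveI : LocallyCompactSpace (Matrix (Fin 3) (Fin 3) K) := inferInstanceAs (LocallyCompactSpace (Fin 3 → Fin 3 → K))
  letI : MeasurableSpace (Matrix (Fin 3) (Fin 3) K) := borel _
  haveI : BorelSpace (Matrix (Fin 3) (Fin 3) K) := ⟨rfl⟩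
  letI : MeasurableSpace F' := borel F'
  haveI : BorelSpace F' := ⟨rfl⟩
  -- the integrand as an opaque class function
  obtain ⟨η, hη⟩ : ∃ η : Matrix (Fin 3) (Fin 3) K → ℝ≥0∞, ∀ X, η X =
      ((NNReal.sqrt (NNReal.sqrt (IsNonarchimedeanLocalField.normAbs K (Matrix.charpoly X).discr)) : ℝ≥0∞))⁻¹ := ⟨_, fun _ => rfl⟩
  have hηeq : η = fun X => ((NNReal.sqrt (NNReal.sqrt (IsNonarchimedeanLocalField.normAbs K (Matrix.charpoly X).discr)) : ℝ≥0∞))⁻¹ := funext hη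
  have hgm : Measurable η := by rw [hηeq]; exact continuous_etaInv.measurable
  have hclass : ∀ X Y : Matrix (Fin 3) (Fin 3) K, X.charpoly = Y.charpoly → η X = η Y := fun X Y h => by rw [hη, hη, h]
  -- `𝔲` as a `ℚ`-submodule (same subtype), the normal-form skew submodule `𝔲'`
  have hS : ((X₀ : Matrix (Fin 3) (Fin 3) K).map σ)ᵀ * J + J * (X₀ : Matrix (Fin 3) (Fin 3) K) = 0 := (h𝔲 _).1 X₀.2
  let 𝔲ℚ : Submodule ℚ (Matrix (Fin 3) (Fin 3) K) :=
    { carrier := 𝔲, zero_mem' := 𝔲.zero_mem, add_mem' := 𝔲.add_mem, smul_mem' := fun c X hX => (h𝔲 _).2 (skew_rat_smul σ J c ((h𝔲 X).1 hX)) }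
  have h𝔲ℚ : ∀ X, X ∈ 𝔲ℚ ↔ (X.map σ)ᵀ * J + J * X = 0 := fun X => h𝔲 X
  obtain ⟨𝔲', h𝔲'⟩ := exists_ratSubmodule_skew σ ((g.map σ)ᵀ * J * g)
  -- Haar measures on the two centraliser slices and on `F′`
  haveI := (isClosed_slice hσc J (X₀ : Matrix (Fin 3) (Fin 3) K) 𝔲ℚ h𝔲ℚ).locallyCompactSpace
  haveI := (isClosed_slice hσc ((g.map σ)ᵀ * J * g) (g⁻¹ * (X₀ : Matrix (Fin 3) (Fin 3) K) * g) 𝔲' h𝔲').locallyCompactSpace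
  haveI : SecondCountableTopology ↥(𝔲' ⊓ (LinearMap.ker (LinearMap.mulLeft K (g⁻¹ * (X₀ : Matrix (Fin 3) (Fin 3) K) * g) -
      LinearMap.mulRight K (g⁻¹ * (X₀ : Matrix (Fin 3) (Fin 3) K) * g) : Module.End K (Matrix (Fin 3) (Fin 3) K))).restrictScalars ℚ) :=
    TopologicalSpace.Subtype.secondCountableTopology _
  let μ𝔠 : Measure ↥(𝔲ℚ ⊓ (LinearMap.ker (LinearMap.mulLeft K (X₀ : Matrix (Fin 3) (Fin 3) K) - LinearMap.mulRight K (X₀ : Matrix (Fin 3) (Fin 3) K) :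
      Module.End K (Matrix (Fin 3) (Fin 3) K))).restrictScalars ℚ) := Measure.addHaar
  let μ𝔠' : Measure ↥(𝔲' ⊓ (LinearMap.ker (LinearMap.mulLeft K (g⁻¹ * (X₀ : Matrix (Fin 3) (Fin 3) K) * g) -
      LinearMap.mulRight K (g⁻¹ * (X₀ : Matrix (Fin 3) (Fin 3) K) * g) : Module.End K (Matrix (Fin 3) (Fin 3) K))).restrictScalars ℚ) := Measure.addHaar
  let μF : Measure F' := Measure.addHaar
  -- the separable polynomial `(X − a)(X − b)` kills `X₀`
  have hp : ((X - C a) * (X - C b) : K[X]).Separable :=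
    separable_X_sub_C.mul separable_X_sub_C (isCoprime_X_sub_C_of_isUnit_sub (sub_ne_zero.2 hab).isUnit)
  have hpS : aeval (X₀ : Matrix (Fin 3) (Fin 3) K) ((X - C a) * (X - C b) : K[X]) = 0 := by
    rw [map_mul, map_sub, map_sub, aeval_X, aeval_C, aeval_C, Algebra.algebraMap_eq_smul_one, Algebra.algebraMap_eq_smul_one]
    exact hmin
  -- E₂ on the normal-form slice
  have h2F : (2 : F') ≠ 0 := fun h => h2 (by rw [← map_ofNat ι 2, h, map_zero])
  choose d' hd' using fun i => (hιr (d i)).1 (hd i).1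
  have hd'0 : ∀ i, d' i ≠ 0 := fun i h => (hd i).2 (by rw [← hd' i, h, map_zero])
  have hJ'd : (g.map σ)ᵀ * J * g = diagonal (fun i => ι (d' i)) := by
    rw [hgJ]; congr 1; funext i; rw [hd']
  have h𝔠T : ∀ Z, Z ∈ (𝔲' ⊓ (LinearMap.ker (LinearMap.mulLeft K (g⁻¹ * (X₀ : Matrix (Fin 3) (Fin 3) K) * g) -
      LinearMap.mulRight K (g⁻¹ * (X₀ : Matrix (Fin 3) (Fin 3) K) * g) : Module.End K (Matrix (Fin 3) (Fin 3) K))).restrictScalars ℚ) ↔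
      (Z.map σ)ᵀ * diagonal (fun i => ι (d' i)) + diagonal (fun i => ι (d' i)) * Z = 0 ∧ diagonal ![a, a, b] * Z = Z * diagonal ![a, a, b] := by
    intro Z
    rw [Submodule.mem_inf, Submodule.restrictScalars_mem, LinearMap.mem_ker, LinearMap.sub_apply, LinearMap.mulLeft_apply, LinearMap.mulRight_apply,
      sub_eq_zero, h𝔲', hJ'd, hgX]
  obtain ⟨U₁, hU₁, hU₁i⟩ := exists_nhds_setLIntegral_etaInv_lt_top_normalForm σ hσ hσc ι hι hιr hιn lam hlam h2F d' hd'0 hab _ h𝔠T μ𝔠' μF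
  -- ball form on the normal-form slice, with the opaque integrand
  have hpt : ∀ Z : Matrix (Fin 3) (Fin 3) K, η (g⁻¹ * (X₀ : Matrix (Fin 3) (Fin 3) K) * g + Z) =
      ((NNReal.sqrt (NNReal.sqrt (IsNonarchimedeanLocalField.normAbs K (Matrix.charpoly (diagonal ![a, a, b] + Z)).discr)) : ℝ≥0∞))⁻¹ := fun Z => by
    rw [hη, hgX]
  have hball' : ∃ ρ : ℝ, 0 < ρ ∧ ∫⁻ Z in closedBall (0 : ↥(𝔲' ⊓ (LinearMap.ker (LinearMap.mulLeft K (g⁻¹ * (X₀ : Matrix (Fin 3) (Fin 3) K) * g) -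
      LinearMap.mulRight K (g⁻¹ * (X₀ : Matrix (Fin 3) (Fin 3) K) * g) : Module.End K (Matrix (Fin 3) (Fin 3) K))).restrictScalars ℚ)) ρ,
      η (g⁻¹ * (X₀ : Matrix (Fin 3) (Fin 3) K) * g + (Z : Matrix (Fin 3) (Fin 3) K)) ∂μ𝔠' < ∞ := by
    refine (exists_ball_iff_exists_nhds _ (fun U => ∫⁻ Z in U, η (g⁻¹ * (X₀ : Matrix (Fin 3) (Fin 3) K) * g + (Z : Matrix (Fin 3) (Fin 3) K)) ∂μ𝔠' < ∞)
      (fun s t hst ht => lt_of_le_of_lt (lintegral_mono_set hst) ht)).2 ⟨U₁, hU₁, ?_⟩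
    simp_rw [hpt]
    exact hU₁i
  -- transport back to `𝔠_J(X₀)` (★ (ii-T)) and conclude by ★ file D
  have hball := (exists_ball_setLIntegral_lt_top_iff_conj σ hg rfl 𝔲ℚ 𝔲' h𝔲ℚ h𝔲' (X₀ : Matrix (Fin 3) (Fin 3) K) μ𝔠 μ𝔠' η hclass).2 hball'
  have hD := exists_nhds_setLIntegral_lt_top_of_slice σ J hJd hσc 𝔲ℚ h𝔲ℚ hS hp hpS μ μ𝔠 η hgm hclass hball
  simp_rw [hη] at hD
  exact hD

/-! ## §3 The other multiplicity pattern `(a,b,b)` (swap the basis vectors `0 ↔ 2`) and the head consuming (ii-B) -/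

omit [ValuativeRel K] [TopologicalSpace K] [IsNonarchimedeanLocalField K] [CharZero K] in
/-- Products `(X − x)(X − y)` of commuting scalar translates expand symmetrically. [cite: Rogawski1990, §3.6 pp. 28–31] -/
theorem sub_smul_one_mul_sub_smul_one (X : Matrix (Fin 3) (Fin 3) K) (x y : K) :
    (X - x • (1 : Matrix (Fin 3) (Fin 3) K)) * (X - y • 1) = (X - y • (1 : Matrix (Fin 3) (Fin 3) K)) * (X - x • 1) := by
  have key : ∀ u v : K, (X - u • (1 : Matrix (Fin 3) (Fin 3) K)) * (X - v • 1) = X * X - (u + v) • X + (u * v) • (1 : Matrix (Fin 3) (Fin 3) K) := by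
    intro u v
    rw [sub_mul, mul_sub, mul_sub, Matrix.mul_smul, Matrix.mul_one, Matrix.smul_mul, Matrix.one_mul, Matrix.smul_mul, Matrix.one_mul, smul_smul, add_smul]
    abel
  rw [key, key, add_comm y x, mul_comm y x]

/-- **SEMISIMPLE DESCENT, GIVEN A NORMAL-FORM BASIS OF PATTERN `(a,b,b)`**: the same conclusion when `g⁻¹ X₀ g = diagonal ![a, b, b]` — right-multiply `g` by the
permutation matrix of the transposition `(0 2)` (entries `0∕1`, `σ`-fixed, symmetric, involutive), which turns the pattern into `diagonal ![b, b, a]` and `diagonal d` into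
`diagonal (d ∘ swap)`, and apply `exists_nhds_setLIntegral_etaInv_lt_top_of_normalFormBasis` with `(b, a)`.
[cite: HarishChandra1970, Part VII §1 Thm. 15] [cite: Rogawski1990, §3.6 pp. 28–31] -/
theorem exists_nhds_setLIntegral_etaInv_lt_top_of_normalFormBasis'
    (σ : K →+* K) (hσ : ∀ x, σ (σ x) = x) (hσc : Continuous σ)
    {J : Matrix (Fin 3) (Fin 3) K} (hJd : IsUnit J.det) (h2 : (2 : K) ≠ 0)
    (lam : Kˣ) (hlam : σ (lam : K) = -(lam : K))
    (𝔲 : AddSubgroup (Matrix (Fin 3) (Fin 3) K)) (h𝔲 : ∀ X, X ∈ 𝔲 ↔ (X.map σ)ᵀ * J + J * X = 0)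
    [MeasurableSpace ↥𝔲] [BorelSpace ↥𝔲] (μ : Measure ↥𝔲) [μ.IsAddHaarMeasure]
    {F' : Type*} [Field F'] [ValuativeRel F'] [TopologicalSpace F'] [IsNonarchimedeanLocalField F']
    (ι : F' →+* K) (hι : IsClosedEmbedding ι) (hιr : ∀ x, σ x = x ↔ x ∈ Set.range ι)
    (hιn : ∀ x : F', IsNonarchimedeanLocalField.normAbs K (ι x) = IsNonarchimedeanLocalField.normAbs F' x ^ 2)
    (X₀ : ↥𝔲) {a b : K} (hab : a ≠ b)
    (hmin : ((X₀ : Matrix (Fin 3) (Fin 3) K) - a • (1 : Matrix (Fin 3) (Fin 3) K)) * ((X₀ : Matrix (Fin 3) (Fin 3) K) - b • 1) = 0)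
    {g : Matrix (Fin 3) (Fin 3) K} (hg : IsUnit g.det) (hgX : g⁻¹ * (X₀ : Matrix (Fin 3) (Fin 3) K) * g = diagonal ![a, b, b])
    {d : Fin 3 → K} (hd : ∀ i, σ (d i) = d i ∧ d i ≠ 0) (hgJ : (g.map σ)ᵀ * J * g = diagonal d) :
    ∃ U ∈ 𝓝 X₀, ∫⁻ X in U,
      ((NNReal.sqrt (NNReal.sqrt (IsNonarchimedeanLocalField.normAbs K (Matrix.charpoly (X : Matrix (Fin 3) (Fin 3) K)).discr)) : ℝ≥0∞))⁻¹ ∂μ < ∞ := by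
  classical
  -- the permutation matrix of `(0 2)`
  set P : Matrix (Fin 3) (Fin 3) K := (Equiv.swap (0 : Fin 3) 2).toPEquiv.toMatrix with hP
  have hPP : P * P = 1 := by
    rw [hP, ← PEquiv.toMatrix_trans, ← Equiv.toPEquiv_trans, show (Equiv.swap (0 : Fin 3) 2).trans (Equiv.swap (0 : Fin 3) 2) = Equiv.refl _ from
      Equiv.ext fun x => by simp, Equiv.toPEquiv_refl, PEquiv.toMatrix_refl]
  have hPinv : P⁻¹ = P := Matrix.inv_eq_left_inv hPP
  have hPt : Pᵀ = P := by rw [hP, ← PEquiv.toMatrix_symm, ← Equiv.toPEquiv_symm, Equiv.symm_swap]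
  have hPσ : P.map σ = P := by
    ext i j
    simp only [hP, Matrix.map_apply, PEquiv.toMatrix_apply, apply_ite σ, map_one, map_zero]
  have hconj : ∀ v : Fin 3 → K, P * diagonal v * P = diagonal (v ∘ Equiv.swap (0 : Fin 3) 2) := fun v => by
    rw [hP, PEquiv.toMatrix_toPEquiv_mul, PEquiv.mul_toMatrix_toPEquiv, Matrix.submatrix_submatrix, Equiv.symm_swap, Function.comp_id, Function.id_comp,
      Matrix.submatrix_diagonal_equiv]
  have hpat : (![a, b, b] : Fin 3 → K) ∘ Equiv.swap (0 : Fin 3) 2 = ![b, b, a] := by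
    funext i
    fin_cases i <;> simp [Equiv.swap_apply_of_ne_of_ne]
  refine exists_nhds_setLIntegral_etaInv_lt_top_of_normalFormBasis σ hσ hσc hJd h2 lam hlam 𝔲 h𝔲 μ ι hι hιr hιn X₀ hab.symm ?_ (g := g * P) ?_ ?_
    (d := d ∘ Equiv.swap (0 : Fin 3) 2) (fun i => hd _) ?_
  · rw [sub_smul_one_mul_sub_smul_one]; exact hmin
  · rw [det_mul]; exact hg.mul (isUnit_det_of_right_inverse hPP)
  · rw [Matrix.mul_inv_rev, hPinv, show P * g⁻¹ * (X₀ : Matrix (Fin 3) (Fin 3) K) * (g * P) = P * (g⁻¹ * (X₀ : Matrix (Fin 3) (Fin 3) K) * g) * P by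
      simp only [Matrix.mul_assoc], hgX, hconj, hpat]
  · rw [Matrix.map_mul, hPσ, transpose_mul, hPt, show P * (g.map σ)ᵀ * J * (g * P) = P * ((g.map σ)ᵀ * J * g) * P by simp only [Matrix.mul_assoc], hgJ, hconj]

/-- **SEMISIMPLE DESCENT AT A SPLIT-SEMISIMPLE NON-REGULAR POINT** (ROAD «HC-D», brick (D5ii) = the `hss` input of ★ GLOBAL-FINAL, modulo the normal-form basis
existence (ii-B) taken as the hypothesis `hB2` in the letters of its sigsheet (LH10-p01): a `g` with `det g` a unit, `g⁻¹ X₀ g = diagonal ![a, a, b]` or `diagonal ![a, b, b]`,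
and `ᵗ(σ g) J g = diagonal d` with `σ dᵢ = dᵢ ≠ 0`; from `g : GL (Fin 3) K` use `⟨↑g, Matrix.isUnits_det_units g, …⟩` and `Matrix.coe_units_inv`).  Conclusion: `ηι` has
finite `∫⁻` on a neighbourhood of `X₀` in `↥𝔲`, for ANY Borel structure and ANY additive Haar measure on `↥𝔲`.
[cite: HarishChandra1970, Part VI Lemma 22; Part VII §1 Thm. 15] [cite: Rogawski1990, §3.6 pp. 28–31; §12.5 p. 184] [cite: Folland1999, §11.1 Thm. 11.9] -/
theorem exists_nhds_setLIntegral_etaInv_lt_top_of_splitSemisimple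
    (σ : K →+* K) (hσ : ∀ x, σ (σ x) = x) (hσc : Continuous σ)
    {J : Matrix (Fin 3) (Fin 3) K} (hJd : IsUnit J.det) (h2 : (2 : K) ≠ 0)
    (lam : Kˣ) (hlam : σ (lam : K) = -(lam : K))
    (𝔲 : AddSubgroup (Matrix (Fin 3) (Fin 3) K)) (h𝔲 : ∀ X, X ∈ 𝔲 ↔ (X.map σ)ᵀ * J + J * X = 0)
    [MeasurableSpace ↥𝔲] [BorelSpace ↥𝔲] (μ : Measure ↥𝔲) [μ.IsAddHaarMeasure]
    {F' : Type*} [Field F'] [ValuativeRel F'] [TopologicalSpace F'] [IsNonarchimedeanLocalField F']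
    (ι : F' →+* K) (hι : IsClosedEmbedding ι) (hιr : ∀ x, σ x = x ↔ x ∈ Set.range ι)
    (hιn : ∀ x : F', IsNonarchimedeanLocalField.normAbs K (ι x) = IsNonarchimedeanLocalField.normAbs F' x ^ 2)
    (X₀ : ↥𝔲) {a b : K} (hab : a ≠ b)
    (hmin : ((X₀ : Matrix (Fin 3) (Fin 3) K) - a • (1 : Matrix (Fin 3) (Fin 3) K)) * ((X₀ : Matrix (Fin 3) (Fin 3) K) - b • 1) = 0)
    (hB2 : ∃ g : Matrix (Fin 3) (Fin 3) K, IsUnit g.det ∧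
      (g⁻¹ * (X₀ : Matrix (Fin 3) (Fin 3) K) * g = diagonal ![a, a, b] ∨ g⁻¹ * (X₀ : Matrix (Fin 3) (Fin 3) K) * g = diagonal ![a, b, b]) ∧
      ∃ d : Fin 3 → K, (∀ i, σ (d i) = d i ∧ d i ≠ 0) ∧ (g.map σ)ᵀ * J * g = diagonal d) :
    ∃ U ∈ 𝓝 X₀, ∫⁻ X in U,
      ((NNReal.sqrt (NNReal.sqrt (IsNonarchimedeanLocalField.normAbs K (Matrix.charpoly (X : Matrix (Fin 3) (Fin 3) K)).discr)) : ℝ≥0∞))⁻¹ ∂μ < ∞ := by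
  obtain ⟨g, hg, hor, d, hd, hgJ⟩ := hB2
  rcases hor with h | h
  · exact exists_nhds_setLIntegral_etaInv_lt_top_of_normalFormBasis σ hσ hσc hJd h2 lam hlam 𝔲 h𝔲 μ ι hι hιr hιn X₀ hab hmin hg h hd hgJ
  · exact exists_nhds_setLIntegral_etaInv_lt_top_of_normalFormBasis' σ hσ hσc hJd h2 lam hlam 𝔲 h𝔲 μ ι hι hιr hιn X₀ hab hmin hg h hd hgJ

end Assembly

end Summit.HodgeConjecture.HodgeConjecture.Cruxes.H413.F0P3cStCharTSHCDescentSemisimpleAssembly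

end
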